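import Literature.MathematicalPhysics.QuantumFieldTheory.Balaban1983to89.B9Eq3124HZKnitPairReg335Y
import Literature.MathematicalPhysics.QuantumFieldTheory.Balaban1983to89.Node00.OpsYCubeDirInverse
import Literature.MathematicalPhysics.QuantumFieldTheory.Balaban1983to89.B9WalkLettersOpsO

/-!
# `Balaban1983to89.B9KnitTransporterLocalityY` — T. Bałaban, *Propagators for lattice gauge theories in a background field*, Commun. Math. Phys. **99** (1985)
# 389–434 [Balaban1985BackgroundPropagators] (3.19) p. 393, (3.24) p. 394, p. 394 L30–33 («They depend on the configuration `U` restricted to `Ω₀`»), p. 410 L14–15;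
# T. Bałaban, *Averaging operations for lattice gauge theories*, Commun. Math. Phys. **98** (1985) 17–51 [Balaban1985Averaging] p. 24 (the sentence after (43):
# the averages «involve only the bond variables `U_b`, `b ⊂ B^j(y)`»): ★★ **THE KNIT SITE TRANSPORTER `parKnitY U` IS LOCAL IN `U`, AND SO IS THE DIRICHLET CUBE
# INVERSE `G′_□(U; parKnitY)`** — the junction side of node00-def-Y's `Node00.OpsYCubeDirInverse.GpDirY_congr_of_agree` («the transporter clause is the letter
# `par`'s own locality, discharged on the junction side»).

statement-level skeleton of published theorems with citation tags; proofs where landed; nothing here is a claim about the Yang–Mills mass gap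

WHAT.  [B9] p. 394: the operators with Dirichlet boundary conditions *"depend on the configuration `U` restricted to `Ω₀`"*.  At def-Y's letters the cube operator is
`G′_□(U) = GpDirY i □ par S U = (Ω₀Δ′_{a,□}(U)Ω₀)⁻¹` (✓`Node00.OpsYCubeDirInverse`, road P4), whose `U`-dependence is (i) the bond variables at the sites of `S = Ω₀(□)`
(the covariant Laplacian) and (ii) the averaging transporters `U(Γ_{z,c})U(Γ_{c,w})` of the cube-level averaging pairs issuing from `S` (def-Y's `GpDirY_congr_of_agree`,
hypotheses `hU`, `hpar`).  For the KNIT transporter `par := parKnitY i` ([5] (52)–(53): the composite contour variables `U(Γ^{(j)}_{y,w})` of the iterated averages) clause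
(ii) is itself a BOND statement: *"the above expressions involve only the bond variables `U_b` for `b ⊂ B^j(y)`"* ([5] p. 24; in the tree `B9Eq3124HZKnitPairReg335Y.compT_bgT_congr`).
THIS FILE turns that into def-Y's currency:
* §1 `agreeOn_liftCfg_of_blk` (agreement of two member backgrounds at the box sites of a block of `𝔅` ⇒ [5]'s `AgreeOn` of their periodic lifts on the block box),
  ★ `knitT_liftCfg_congr` (the knit leg to `w` reads `U` on the member-block of `w` only), ★ `parKnitY_congr_of_agree` (the site transporter `parKnitY U z w` reads `U` on the
  member-blocks of `z` and `w` only), `avgTrY_parKnitY_congr`, `avgTrCubeY_parKnitY_congr` (the averaging transporter through the member-level ∕ cube-level corner).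
* §2 the KNIT REACH `knitReachY i □ S` of a site set (the member-blocks of `z`, of its cube-level corner and of its averaging partners, `z ∈ S`) and ★★ `GpDirY_parKnitY_congr_of_agree`:
  `G′_□(U; parKnitY) = G′_□(U′; parKnitY)` as soon as `U ≡ U′` at the bonds of the sites of `S` and of `knitReachY i □ S` — BOND AGREEMENT ALONE.
* §3 at a k-level member, from the walk-reading agreement predicate `B9WalkLettersOpsO.agreeWalkYO … near □` (the `LocDep` currency of the N06 certificate): ★★
  `GpDirY_parKnitY_congr_of_agreeWalkYO` given the two inclusions `S ⊆ near □`, `knitReachY … S ⊆ near □` — the `hOagr` row of the knit head at the pinned letter.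

* §4 (v1.1) `exists_mem_blkOf_eq_of_mem_knitReachY_of_nearH`, ★ `knitReachY_subset_of_nearH_of_blkHull`: on `S ⊆ NearH(□)` the knit reach lies in the member-blocks meeting `S`.

HONEST SCOPE.  Exact bookkeeping over landed modules (no estimate; no choice of `S = Ω₀(□)` — dag-n06-c's D3; no claim that `knitReachY … S ⊆ □̃⁵`, a cover-geometry fact left
to the consumer's choice of `near`).  Count-neutral; N06 NOT discharged; nothing continuum ∕ OS ∕ mass gap ∕ Clay.  Cell `pub-ymgap` (D-0062), Track A node N06 [B9], seat
`pub-ymgap-dag-n06-d` (g32), 2026-08-31; NEW file; nothing landed is modified.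
-/

noncomputable section

namespace Literature.MathematicalPhysics.QuantumFieldTheory.Balaban1983to89.B9KnitTransporterLocalityY

open B7Prop1Explicit renaming Site → LSite
open B7Prop1Local (InBox AgreeOn)
open Literature.MathematicalPhysics.QuantumLattice (blockBase blockMap)
open B8Eq119TwistedAxial (bgT)
open B4Reflection242 (blk)
open B6Geom246MultiLevelBox (blkOf blkOf_eq_iff_blk)
open B6GlobalChartV1 (PV boxEquiv)
open B6KLevelCensusIndexV1 (KIdx)
open B6Cover236MultiLevelBlocks (cubes)
open B10Eq27TorusAxialLog (transl)
open B9B8CarrierDictionary (liftCfg liftCfg_apply)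
open B9B8AveragingKernelZd (compT)
open B9B8AveragingJunction (knitT parOfT parKnitY blockMap_iterate blk_eq_blockMap mem_XB_of_blk_eq boxEquiv_transl_of_mem)
open B9Eq3124HZKnitPairReg335Y (compT_bgT_congr blk_eq_of_inBox_block)
open B9CubeLettersOpsL0 (levCubeY avgCoeffCubeY avgTrCubeY)
open B9PinMembersKLevelV1 (MemberY)
open B9WalkLettersOpsO (agreeWalkYO)
open Node00
open Node00.OpsYCubeDirInverse (GpDirY GpDirY_congr_of_agree)

variable {d ℓ : ℕ} {hd : 1 ≤ d + 1} {hL : Odd (ℓ + 1) ∧ 1 < ℓ + 1} {b₀ b₁ : ℝ}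
variable {𝔸 : Type} [NormedRing 𝔸] [NormedAlgebra ℂ 𝔸] [CompleteSpace 𝔸]

/-! ## §1 The knit legs and the knit site transporter read `U` on member-blocks only -/

section Legs

variable (i : KIdx d ℓ hd hL b₀ b₁)

/-- two member backgrounds agreeing at the box bonds of every site of the block `s ∈ 𝔅` have periodic lifts agreeing, in [5]'s sense `AgreeOn`, on the block box
`[L^{j_s}y_s, L^{j_s}y_s + (L^{j_s} − 1)𝟙]` (the box chart `boxEquiv` is the identity on the fundamental box). [cite: Balaban1985Averaging, p.24 (locality sentence after (43));
Balaban1984PropagatorsII, (2.1) p.224 (the blocks), dictionary] -/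
theorem agreeOn_liftCfg_of_blk {U U' : CfgY 𝔸 i} (s : BlkY i)
    (h : ∀ v : SiteY i, blkOf i.D.toDomains v = s → ∀ μ, UboxY i U μ v = UboxY i U' μ v) :
    AgreeOn (blockBase ((ℓ + 1) ^ s.1.1) s.1.2) (blockBase ((ℓ + 1) ^ s.1.1) s.1.2 + ((((ℓ + 1 : ℕ) : ℤ) ^ s.1.1) - 1) • (1 : LSite (d + 1)))
      (liftCfg U) (liftCfg U') := by
  intro x μ hx _
  have hblk : blk ((ℓ + 1) ^ s.1.1) x = s.1.2 := blk_eq_of_inBox_block hx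
  have hxXB : x ∈ (toKT i).XB := mem_XB_of_blk_eq i s hblk
  have hv : blkOf i.D.toDomains (⟨x, hxXB⟩ : SiteY i) = s := (blkOf_eq_iff_blk i.D.toDomains).2 hblk
  have hsymm : (boxEquiv i.hN).symm ⟨x, hxXB⟩ = transl 0 x := by
    rw [Equiv.symm_apply_eq]
    exact (boxEquiv_transl_of_mem i hxXB).symm
  have e : ∀ V : CfgY 𝔸 i, liftCfg V x μ = UboxY i V μ ⟨x, hxXB⟩ := fun V => by
    rw [liftCfg_apply]
    exact (congrArg (V μ) hsymm).symm
  rw [e U, e U']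
  exact h ⟨x, hxXB⟩ hv μ

/-- ★ **THE KNIT LEG `U(Γ^{(j_w)}_{y_w,w})` READS `U` ON THE MEMBER-BLOCK OF `w` ONLY**: two backgrounds agreeing at the box bonds of the sites of `B(w)` give the same leg
([5] p. 24 «involve only the bond variables `U_b`, `b ⊂ Bʲ(y)`»; the tree's `compT_bgT_congr` read through §1's chart lemma).
[cite: Balaban1985Averaging, p.24 (locality sentence after (43)), (52)–(53) p.27; Balaban1985BackgroundPropagators, (3.19) p.393] -/
theorem knitT_liftCfg_congr {U U' : CfgY 𝔸 i} (w : SiteY i)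
    (h : ∀ v : SiteY i, blkOf i.D.toDomains v = blkOf i.D.toDomains w → ∀ μ, UboxY i U μ v = UboxY i U' μ v) :
    knitT i (bgT (ℓ + 1) (liftCfg U)) w = knitT i (bgT (ℓ + 1) (liftCfg U')) w := by
  have hL1 : 1 ≤ ℓ + 1 := Nat.succ_pos ℓ
  set s : BlkY i := blkOf i.D.toDomains w with hs
  set j : ℕ := s.1.1 with hj
  have hjw : levY i w = j := rfl
  have hyw : blk ((ℓ + 1) ^ j) w.1 = s.1.2 := rfl
  have hit : (blockMap (ℓ + 1))^[j] w.1 = s.1.2 := by rw [blockMap_iterate, ← blk_eq_blockMap]; exact hyw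
  show compT (ℓ + 1) (bgT (ℓ + 1) (liftCfg U)) (levY i w) (blk ((ℓ + 1) ^ levY i w) w.1) w.1 =
    compT (ℓ + 1) (bgT (ℓ + 1) (liftCfg U')) (levY i w) (blk ((ℓ + 1) ^ levY i w) w.1) w.1
  rw [hjw, hyw, ← hit]
  exact compT_bgT_congr hL1 j w.1 (by rw [hit]; exact agreeOn_liftCfg_of_blk i s h)

/-- ★ **THE KNIT SITE TRANSPORTER `U(Γ_{z,w}) = parKnitY U z w` READS `U` ON THE MEMBER-BLOCKS OF `z` AND `w` ONLY** (a leg to `w`, an inverse leg to `z`, or `1`).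
[cite: Balaban1985BackgroundPropagators, (3.19) p.393, (3.24)–(3.25) pp.394–395; Balaban1985Averaging, p.24 (locality sentence after (43))] -/
theorem parKnitY_congr_of_agree {U U' : CfgY 𝔸 i} (z w : SiteY i)
    (hz : ∀ v : SiteY i, blkOf i.D.toDomains v = blkOf i.D.toDomains z → ∀ μ, UboxY i U μ v = UboxY i U' μ v)
    (hw : ∀ v : SiteY i, blkOf i.D.toDomains v = blkOf i.D.toDomains w → ∀ μ, UboxY i U μ v = UboxY i U' μ v) :
    parKnitY i U z w = parKnitY i U' z w := by
  show parOfT i (bgT (ℓ + 1) (liftCfg U)) z w = parOfT i (bgT (ℓ + 1) (liftCfg U')) z w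
  unfold parOfT
  split_ifs
  · exact knitT_liftCfg_congr i w hw
  · rw [knitT_liftCfg_congr i z hz]
  · rfl

/-- the member-level averaging transporter `U(Γ_{z,c(z)})U(Γ_{c(z),w})` at the knit letter reads `U` on the member-blocks of `z`, of its corner `c(z)` and of `w`.
[cite: Balaban1985BackgroundPropagators, (3.19) p.393, (3.24) p.394] -/
theorem avgTrY_parKnitY_congr {U U' : CfgY 𝔸 i} (z w : SiteY i)
    (hz : ∀ v : SiteY i, blkOf i.D.toDomains v = blkOf i.D.toDomains z → ∀ μ, UboxY i U μ v = UboxY i U' μ v)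
    (hc : ∀ v : SiteY i, blkOf i.D.toDomains v = blkOf i.D.toDomains (cornerY i (levY i z) z) → ∀ μ, UboxY i U μ v = UboxY i U' μ v)
    (hw : ∀ v : SiteY i, blkOf i.D.toDomains v = blkOf i.D.toDomains w → ∀ μ, UboxY i U μ v = UboxY i U' μ v) :
    avgTrY i (parKnitY i) U z w = avgTrY i (parKnitY i) U' z w := by
  show parKnitY i U z _ * parKnitY i U _ w = parKnitY i U' z _ * parKnitY i U' _ w
  rw [parKnitY_congr_of_agree i z _ hz hc, parKnitY_congr_of_agree i _ w hc hw]

/-- the CUBE-LEVEL averaging transporter (through the `L^{lev_□ z}`-corner of `z`, r05's `avgTrCubeY`) at the knit letter reads `U` on the member-blocks of `z`, of that corner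
and of `w`. [cite: Balaban1985BackgroundPropagators, (3.19) p.393, (3.24) p.394, pp.408–409 (the cube sequence)] -/
theorem avgTrCubeY_parKnitY_congr (q : ↥(cubes (toKT i).D.toDomains)) {U U' : CfgY 𝔸 i} (z w : SiteY i)
    (hz : ∀ v : SiteY i, blkOf i.D.toDomains v = blkOf i.D.toDomains z → ∀ μ, UboxY i U μ v = UboxY i U' μ v)
    (hc : ∀ v : SiteY i, blkOf i.D.toDomains v = blkOf i.D.toDomains (cornerY i (levCubeY i q z) z) → ∀ μ, UboxY i U μ v = UboxY i U' μ v)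
    (hw : ∀ v : SiteY i, blkOf i.D.toDomains v = blkOf i.D.toDomains w → ∀ μ, UboxY i U μ v = UboxY i U' μ v) :
    avgTrCubeY i q (parKnitY i) U z w = avgTrCubeY i q (parKnitY i) U' z w := by
  show parKnitY i U z _ * parKnitY i U _ w = parKnitY i U' z _ * parKnitY i U' _ w
  rw [parKnitY_congr_of_agree i z _ hz hc, parKnitY_congr_of_agree i _ w hc hw]

end Legs

/-! ## §2 The knit reach of a site set; `G′_□(U; parKnitY)` from bond agreement alone -/

section Reach

variable (i : KIdx d ℓ hd hL b₀ b₁) (q : ↥(cubes (toKT i).D.toDomains))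

open Classical in
/-- **THE KNIT REACH `knitReachY i □ S`** of a site set `S`: the box sites `v` sharing a member-block with `z`, with the cube-level corner of `z`, or with an averaging partner `w`
of `z` (`avgCoeffCubeY i □ z w ≠ 0`), for some `z ∈ S` — the sites whose bond variables the transporters of `Ω₀Δ′_{a,□}(U; parKnitY)Ω₀`, `Ω₀ = 𝟙_S`, read (print: inside `□̃⁵` for
`S = Ω₀(□)`; that inclusion is cover geometry and is NOT asserted here). [cite: Balaban1985BackgroundPropagators, p.394 L30–33, p.410 L14–15 («Ω₀(□) ⊂ □̃⁵»), (3.19) p.393] -/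
def knitReachY (S : Finset (SiteY i)) : Finset (SiteY i) :=
  Finset.univ.filter fun v => ∃ z ∈ S, ∃ w, avgCoeffCubeY i q z w ≠ 0 ∧
    (blkOf i.D.toDomains v = blkOf i.D.toDomains z ∨ blkOf i.D.toDomains v = blkOf i.D.toDomains (cornerY i (levCubeY i q z) z) ∨
      blkOf i.D.toDomains v = blkOf i.D.toDomains w)

/-- membership in the knit reach, unfolded. [cite: Balaban1985BackgroundPropagators, p.394 L30–33, bookkeeping] -/
theorem mem_knitReachY {S : Finset (SiteY i)} {v : SiteY i} :
    v ∈ knitReachY i q S ↔ ∃ z ∈ S, ∃ w, avgCoeffCubeY i q z w ≠ 0 ∧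
      (blkOf i.D.toDomains v = blkOf i.D.toDomains z ∨ blkOf i.D.toDomains v = blkOf i.D.toDomains (cornerY i (levCubeY i q z) z) ∨
        blkOf i.D.toDomains v = blkOf i.D.toDomains w) := by
  classical
  simp only [knitReachY, Finset.mem_filter, Finset.mem_univ, true_and]

/-- the knit reach is monotone in the site set. [cite: Balaban1985BackgroundPropagators, p.394 L30–33, bookkeeping] -/
theorem knitReachY_mono {S S' : Finset (SiteY i)} (h : S ⊆ S') : knitReachY i q S ⊆ knitReachY i q S' := by
  intro v hv
  obtain ⟨z, hz, w, hw, hor⟩ := (mem_knitReachY i q).1 hv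
  exact (mem_knitReachY i q).2 ⟨z, h hz, w, hw, hor⟩

/-- ★★ **PRINT's «`G′_□(U)` DEPENDS ON `U` RESTRICTED TO `Ω₀`» AT THE KNIT TRANSPORTER, FROM BOND AGREEMENT ALONE**: if `U ≡ U′` at the box bonds (forward and backward) of the
sites of `S` and at the box bonds of the sites of `knitReachY i □ S`, then `G′_□(U; parKnitY) = G′_□(U′; parKnitY)` (def-Y's `GpDirY_congr_of_agree` with its transporter clause
discharged by §1). [cite: Balaban1985BackgroundPropagators, p.394 L30–33 («They depend on the configuration U restricted to Ω₀»), (3.19) p.393, (3.24) p.394;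
Balaban1985Averaging, p.24] -/
theorem GpDirY_parKnitY_congr_of_agree (S : Finset (SiteY i)) {U U' : CfgY 𝔸 i}
    (hU : ∀ z ∈ S, ∀ μ, UboxY i U μ z = UboxY i U' μ z ∧ UboxY i U μ ((shiftY i μ).symm z) = UboxY i U' μ ((shiftY i μ).symm z))
    (hR : ∀ v ∈ knitReachY i q S, ∀ μ, UboxY i U μ v = UboxY i U' μ v) :
    GpDirY i q (parKnitY i) S U = GpDirY i q (parKnitY i) S U' := by
  refine GpDirY_congr_of_agree i q (parKnitY i) S hU fun z hz w hw => ?_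
  refine avgTrCubeY_parKnitY_congr i q z w (fun v hv μ => hR v ?_ μ) (fun v hv μ => hR v ?_ μ) (fun v hv μ => hR v ?_ μ)
  · exact (mem_knitReachY i q).2 ⟨z, hz, w, hw, Or.inl hv⟩
  · exact (mem_knitReachY i q).2 ⟨z, hz, w, hw, Or.inr (Or.inl hv)⟩
  · exact (mem_knitReachY i q).2 ⟨z, hz, w, hw, Or.inr (Or.inr hv)⟩

end Reach

/-! ## §3 At a k-level member: the `hOagr` row of the knit certificate at the pinned letter -/

section Member

variable {Mstar : ℕ}
variable (x : MemberY d ℓ hd hL b₀ b₁ Mstar) (B : B9.Backgrounds) (cfg : B.Cfg → CfgY 𝔸 x.toKIdx)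

/-- ★★ **THE WALK READING's AGREEMENT PREDICATE GIVES `G′_□(U; parKnitY) = G′_□(U′; parKnitY)`** whenever the reading domain `near □` contains `S = Ω₀(□)` and its knit reach:
the locality row `hOagr` of the N06 knit certificate at `O x □ := GpDirY x.toKIdx □ (parKnitY x.toKIdx) (S □)` (bond clause of `agreeWalkYO` on `near □`; its transporter
clause is not needed). [cite: Balaban1985BackgroundPropagators, p.394 L30–33, p.410 L14–15 («G′_□ depends on U restricted to Ω₀(□) ⊂ □̃⁵»), (3.88) p.409] -/
theorem GpDirY_parKnitY_congr_of_agreeWalkYO (near : ↥(cubes x.toKIdx.D.toDomains) → Finset (SiteY x.toKIdx)) (c : ↥(cubes x.toKIdx.D.toDomains))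
    (S : Finset (SiteY x.toKIdx)) (hS : S ⊆ near c) (hR : knitReachY x.toKIdx c S ⊆ near c) {U U' : B.Cfg}
    (h : agreeWalkYO x B cfg (parKnitY x.toKIdx) near c U U') :
    GpDirY x.toKIdx c (parKnitY x.toKIdx) S (cfg U) = GpDirY x.toKIdx c (parKnitY x.toKIdx) S (cfg U') :=
  GpDirY_parKnitY_congr_of_agree x.toKIdx c S (fun z hz μ => h.1 z (hS hz) μ) (fun v hv μ => (h.1 v (hR hv) μ).1)

end Member

/-! ## §4 (v1.1) On exteriors inside `NearH(□)` the knit reach is contained in the member-block hull -/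

section NearHReach

open B6Geom246MultiLevelBox (blkOf_corner)
open B9CubeLettersOpsL0 (levCubeY_eq_levY_of_nearH avgCoeffCubeY_eq_of_nearH)
open B9CubeSequence408 (NearH)
open B9Thm311DeltaPrimeSymm (cornerY_levY_eq)
open B9Thm37TransposedCommutator (blkOf_eq_of_avgCoeffY_ne_zero)

variable (i : KIdx d ℓ hd hL b₀ b₁) (q : ↥(cubes (toKT i).D.toDomains))

/-- ★ **ON `S ⊆ NearH(□)` THE KNIT REACH OF `S` LIES IN THE MEMBER-BLOCKS MEETING `S`**: near □ the cube sequence's levels are the member's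
(✓`B9CubeLettersOpsL0.levCubeY_eq_levY_of_nearH`, `avgCoeffCubeY_eq_of_nearH`), so the cube-level corner of `z ∈ S` is the corner of the member-block of `z` and every
averaging partner of `z` lies in that block (✓`B9Thm37TransposedCommutator.blkOf_eq_of_avgCoeffY_ne_zero`) — the consumer's row `hSblk : knitReachY … (S □) ⊆ near □` then
follows from «every member-block meeting `Ω₀(□)` lies in `near □`» (v1.1, for the edition «KE₁₁X-A»'s geometric rows `hSH`, `hSblk`).
[cite: Balaban1985BackgroundPropagators, p.394 L30–33, p.410 L14–15, (3.19) p.393, (3.24) p.394; Balaban1984PropagatorsII, (2.14) p.225] -/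
theorem exists_mem_blkOf_eq_of_mem_knitReachY_of_nearH {S : Finset (SiteY i)} (hS : ∀ z ∈ S, NearH q z.1) {v : SiteY i}
    (hv : v ∈ knitReachY i q S) : ∃ z ∈ S, blkOf i.D.toDomains v = blkOf i.D.toDomains z := by
  obtain ⟨z, hz, w, hw, hor⟩ := (mem_knitReachY i q).1 hv
  refine ⟨z, hz, ?_⟩
  have hlev : levCubeY i q z = levY i z := levCubeY_eq_levY_of_nearH i q (hS z hz)
  rcases hor with h | h | h
  · exact h
  · rw [h, hlev, cornerY_levY_eq]
    exact blkOf_corner i.D.toDomains _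
  · rw [h]
    have hw' : avgCoeffY i z w ≠ 0 := by rwa [avgCoeffCubeY_eq_of_nearH i q (hS z hz)] at hw
    exact blkOf_eq_of_avgCoeffY_ne_zero i hw'

/-- hence `hSblk` from a block-hull inclusion: if every member-block meeting `S ⊆ NearH(□)` lies in `D`, then `knitReachY i □ S ⊆ D`.
[cite: Balaban1985BackgroundPropagators, p.394 L30–33, p.410 L14–15 («Ω₀(□) ⊂ □̃⁵»)] -/
theorem knitReachY_subset_of_nearH_of_blkHull {S D : Finset (SiteY i)} (hS : ∀ z ∈ S, NearH q z.1)
    (hD : ∀ v : SiteY i, ∀ z ∈ S, blkOf i.D.toDomains v = blkOf i.D.toDomains z → v ∈ D) : knitReachY i q S ⊆ D := by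
  intro v hv
  obtain ⟨z, hz, h⟩ := exists_mem_blkOf_eq_of_mem_knitReachY_of_nearH i q hS hv
  exact hD v z hz h

end NearHReach

end Literature.MathematicalPhysics.QuantumFieldTheory.Balaban1983to89.B9KnitTransporterLocalityY

end
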